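import Literature.NumberTheory.QuadraticFields.GaussianQuarticSymbol
import HarnessLib

/-!
# Values of the quartic symbol `(D/x)₄` on `GaussianInt`: Euler's criterion, inert primes, and the prime `3`

Topic `Literature/NumberTheory/QuadraticFields`, namespace `Literature.NumberTheory.QuadraticFields.GaussianQuarticSymbol`.
Theorems only (no definition, no named fact), continuing `GaussianQuarticSymbol.lean` (the bridge
`Φ₄ : GaussianInt ≃+* 𝓞 ℚ(ζ₄)` and `quarticSymbolInt D x = (D/x)₄`): the facts about `(D/x)₄` that Ireland–Rosen use
for the Hecke character `χ(P) = \overline{(D/π)₄} π` of `y² = x³ − Dx` (Ch. 18 §6), transported from the tree's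
`𝓞 K`-currency theorems to Mathlib's `GaussianInt`:

* `quarticSymbolInt_spec_of_norm_eq`, `quarticSymbolInt_eq_of_dvd` — Euler's criterion and uniqueness at a split prime
  `π`, `N(π) = p ≡ 1 (4)`, `p ∤ D`: `(D/π)₄⁴ = 1`, `π ∣ D^{(p-1)/4} − (D/π)₄` (Prop. 9.8.2; this is the hypothesis
  `π ∣ D^{(p-1)/4} − i^k` of the tree's point count `IrelandRosen1990_card_points_one_mod_four`);
* `quarticSymbolInt_natCast_of_mod_four_eq_three` (and `_neg_natCast_…`) — `(D/q)₄ = 1` at an inert `q ≡ 3 (4)`, `q ∤ D`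
  (Ch. 18 §6, Lemma);
* `quarticSymbolInt_neg_three_of_isPrimary` — `(-3/x)₄ = (x/3)₄ = quarticCharThree x` for primary `x`, and the `3`-part
  split `((-3)^k D₁/x)₄ = (x/3)₄^k (D₁/x)₄` (`quarticSymbolInt_neg_three_pow_mul_of_isPrimary`).

## References
* K. Ireland, M. Rosen, *A Classical Introduction to Modern Number Theory* (1982/1990), Ch. 9 §8 Prop. 9.8.2, §9 Prop. 9.9.8;
  Ch. 18 §6 Lemma and Theorem 7 (proof). [IrelandRosen1982]

## Mathlib / tree search
Tree: `quarticResidueSymbol_spec`, `quarticResidueSymbol_eq_of_pow_four_eq_one`, `quarticResidueSymbol_zero_of_two_not_mem`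
(`QuarticResidueSymbol`); `quarticSymbol_span_of_span_eq`, `quarticSymbol_span_neg`, `inertPlace`, `residueCard_inertPlace`,
`two_not_mem_inertPlace` (`QuarticResidueSymbolComposite`); `quarticSymbol_span_natCast_intCast_eq_one_of_mod_four_eq_three`
(`QuarticSymbolModulus`); `quarticSymbol_span_eq_of_sub_mem_span` (`QuarticTwistHeckeCharacter`);
`quarticSymbol_span_intCast_primary_comm` (`BiquadraticReciprocityRationalInteger`); `prime_of_norm_eq_prime`, `norm_dvd_norm`,
`cast_norm_eq`, `eq_of_isUnit` (`GaussianPrimary`).  Mathlib: `GaussianInt.prime_iff_mod_four_eq_three_of_nat_prime`,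
`Irreducible.coprime_iff_not_dvd`, `Ideal.isCoprime_span_singleton_iff`, `MulEquiv.prime_iff`.
-/

noncomputable section

namespace Literature.NumberTheory.QuadraticFields.GaussianQuarticSymbol

open NumberField IsDedekindDomain Zsqrtd
open Literature.NumberTheory.NumberFields Literature.NumberTheory.GaloisRepresentations
open Literature.NumberTheory.QuadraticFields.GaussianPrimary

/-! ### §1 Units and norms of `ℤ[i]`; values at split and inert primes -/

section Values

/-- `x⁴ = 1` in `ℤ[i]` forces `x ∈ {1, -1, i, -i}` (the units of `ℤ[i]`). [cite: IrelandRosen1982, Ch. 9 §7 p. 120 («the units ±1, ±i»)] -/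
theorem eq_of_pow_four_eq_one {x : GaussianInt} (h : x ^ 4 = 1) : x = 1 ∨ x = -1 ∨ x = ⟨0, 1⟩ ∨ x = ⟨0, -1⟩ :=
  eq_of_isUnit ⟨⟨x, x ^ 3, by rw [← pow_succ', h], by rw [← pow_succ, h]⟩, rfl⟩

/-- `conj u = u⁻¹ = u³` for a fourth root of unity `u ∈ ℤ[i]` (how `\\overline{χ_π}` becomes `χ_π³`).
[cite: IrelandRosen1982, Ch. 9 §8, Prop. 9.8.3 (c)] -/
theorem star_eq_pow_three_of_pow_four_eq_one {x : GaussianInt} (h : x ^ 4 = 1) : star x = x ^ 3 := by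
  rcases eq_of_pow_four_eq_one h with rfl | rfl | rfl | rfl <;> decide

/-- A Gaussian integer whose norm `λ(x) = x x̄` is coprime to an integer `n` is coprime to `n` in `ℤ[i]`.
[cite: IrelandRosen1982, Ch. 1 §4 («`λ(α) = α ᾱ`»)] -/
theorem isCoprime_of_isCoprime_norm {x : GaussianInt} {n : ℤ} (h : IsCoprime x.norm n) : IsCoprime x (n : GaussianInt) := by
  obtain ⟨u, v, huv⟩ := h
  refine ⟨(u : GaussianInt) * star x, v, ?_⟩
  have : (u : GaussianInt) * star x * x = u * (x.norm : GaussianInt) := by rw [cast_norm_eq]; ring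
  rw [this, ← Int.cast_mul, ← Int.cast_mul, ← Int.cast_add, huv, Int.cast_one]

/-- If `π ∣ D` in `ℤ[i]` for a rational integer `D`, then `N(π) = λ(π) ∣ λ(D) = D²` (multiplicativity of `λ`).
[cite: IrelandRosen1982, Ch. 1 §4 («`λ(αβ) = λ(α)λ(β)`»)] -/
theorem norm_dvd_sq_of_dvd_intCast {π : GaussianInt} {D : ℤ} (h : π ∣ (D : GaussianInt)) : π.norm ∣ D ^ 2 := by
  have := norm_dvd_norm h
  rwa [Zsqrtd.norm_intCast, ← sq] at this

/-- **Euler's criterion for `(D/π)₄` at a split prime** (Ireland–Rosen Prop. 9.8.2 and the Definition: «`χ_π(α)` is the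
unique unit with `α^{(Nπ-1)/4} ≡ χ_π(α) (π)`»): for a Gaussian prime `π` of norm `p ≡ 1 (4)` and `p ∤ D`,
`(D/π)₄⁴ = 1` and `π ∣ D^{(p-1)/4} − (D/π)₄`. [cite: IrelandRosen1982, Ch. 9 §8, Prop. 9.8.2 and Definition] -/
theorem quarticSymbolInt_spec_of_norm_eq {p : ℕ} (hp : p.Prime) (hp1 : p % 4 = 1) {π : GaussianInt} (hπ : π.norm = p)
    {D : ℤ} (hpD : ¬ (p : ℤ) ∣ D) :
    quarticSymbolInt D π ^ 4 = 1 ∧ π ∣ (D : GaussianInt) ^ ((p - 1) / 4) - quarticSymbolInt D π := by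
  haveI := isCyclotomicExtension_K₄
  haveI := Fact.mk hp
  have hπp : Prime π := prime_of_norm_eq_prime hp hπ
  have hπK : Prime (Φ₄ π) := (MulEquiv.prime_iff (Φ₄ : GaussianInt ≃* 𝓞 K₄)).mpr hπp
  let 𝔭 : HeightOneSpectrum (𝓞 K₄) :=
    ⟨Ideal.span {Φ₄ π}, (Ideal.span_singleton_prime hπK.ne_zero).mpr hπK,
      by rw [Ne, Ideal.span_singleton_eq_bot]; exact hπK.ne_zero⟩
  have h𝔭 : 𝔭.asIdeal = Ideal.span {Φ₄ π} := rfl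
  have hcard : 𝔭.residueCard = p := by
    rw [HeightOneSpectrum.residueCard, h𝔭, absNorm_span_Φ₄, hπ, Int.natAbs_natCast]
  -- `𝔭 ∤ 2`: else `p = N(π) ∣ 4`
  have h2 : (2 : 𝓞 K₄) ∉ 𝔭.asIdeal := by
    intro h2
    rw [h𝔭, Ideal.mem_span_singleton, show (2 : 𝓞 K₄) = Φ₄ 2 from (map_ofNat Φ₄ 2).symm,
      map_dvd_iff] at h2
    have h4 : π.norm ∣ (2 : ℤ) ^ 2 := norm_dvd_sq_of_dvd_intCast (by exact_mod_cast h2)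
    rw [hπ] at h4
    have : p ∣ 4 := by exact_mod_cast h4
    have := Nat.le_of_dvd (by norm_num) this
    interval_cases p <;> omega
  -- `D ≢ 0 (𝔭)`: else `p ∣ D`
  have hD : Ideal.Quotient.mk 𝔭.asIdeal (D : 𝓞 K₄) ≠ 0 := by
    intro h0
    rw [Ideal.Quotient.eq_zero_iff_mem, h𝔭, Ideal.mem_span_singleton,
      show (D : 𝓞 K₄) = Φ₄ (D : GaussianInt) from (map_intCast Φ₄ D).symm, map_dvd_iff] at h0
    have h := norm_dvd_sq_of_dvd_intCast h0
    rw [hπ] at h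
    exact hpD (Int.Prime.dvd_pow' hp h)
  obtain ⟨h4, hmk⟩ := quarticResidueSymbol_spec isPrimitiveRoot_ζ₄ h2 hD
  rw [← quarticSymbol_span_of_span_eq h𝔭, ← map_quarticSymbolInt] at h4 hmk
  rw [hcard] at hmk
  refine ⟨Φ₄.injective (by rw [map_pow, h4, map_one]), ?_⟩
  rw [← map_pow, ← map_intCast Φ₄, ← map_pow, Ideal.Quotient.eq, h𝔭, Ideal.mem_span_singleton, ← map_sub,
    map_dvd_iff] at hmk
  rwa [← dvd_neg, neg_sub] at hmk

/-- **Uniqueness at a split prime**: a fourth root of unity `u ∈ GaussianInt` with `π ∣ D^{(p-1)/4} − u` IS `(D/π)₄`.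
[cite: IrelandRosen1982, Ch. 9 §8, Prop. 9.8.2] -/
theorem quarticSymbolInt_eq_of_dvd {p : ℕ} (hp : p.Prime) (hp1 : p % 4 = 1) {π : GaussianInt} (hπ : π.norm = p)
    {D : ℤ} (hpD : ¬ (p : ℤ) ∣ D) {u : GaussianInt} (hu : u ^ 4 = 1) (h : π ∣ (D : GaussianInt) ^ ((p - 1) / 4) - u) :
    quarticSymbolInt D π = u := by
  obtain ⟨h4, hdvd⟩ := quarticSymbolInt_spec_of_norm_eq hp hp1 hπ hpD
  have hπp : Prime π := prime_of_norm_eq_prime hp hπ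
  -- `π ∣ u - (D/π)₄`, both fourth roots of unity, and `N(π) = p ≥ 5`
  have hd : π ∣ u - quarticSymbolInt D π := by
    have := dvd_sub hdvd h; rwa [sub_sub_sub_cancel_left] at this
  by_contra hne
  have hne' : u - quarticSymbolInt D π ≠ 0 := sub_ne_zero.mpr (Ne.symm hne)
  have hle := Int.le_of_dvd (by
    rcases (GaussianInt.norm_nonneg (u - quarticSymbolInt D π)).lt_or_eq with h | h
    · exact h
    · exact absurd (GaussianInt.norm_eq_zero.mp h.symm) hne') (norm_dvd_norm hd)
  rw [hπ] at hle
  have h5 : (5 : ℤ) ≤ p := by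
    have := hp.two_le; have : p ≠ 2 := by rintro rfl; norm_num at hp1
    have : p ≠ 3 := by rintro rfl; norm_num at hp1
    have : p ≠ 4 := by rintro rfl; exact absurd hp (by decide)
    omega
  have hsmall : (u - quarticSymbolInt D π).norm ≤ 4 := by
    rcases eq_of_pow_four_eq_one hu with rfl | rfl | rfl | rfl <;>
      rcases eq_of_pow_four_eq_one h4 with h' | h' | h' | h' <;> rw [h'] <;> decide
  omega

/-- **`(D/q)₄ = 1` at an inert prime `q ≡ 3 (4)`, `q ∤ D`** (Ireland–Rosen Ch. 18 §6, Lemma: `(D/q)₄ ≡ D^{(q²-1)/4}`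
and `q - 1 ∣ (q² - 1)/4`). [cite: IrelandRosen1982, Ch. 18 §6, Lemma before Theorem 7] -/
theorem quarticSymbolInt_natCast_of_mod_four_eq_three {q : ℕ} (hq : q.Prime) (hq3 : q % 4 = 3) {D : ℤ}
    (hqD : ¬ (q : ℤ) ∣ D) : quarticSymbolInt D q = 1 := by
  haveI := isCyclotomicExtension_K₄
  apply Φ₄.injective
  rw [map_quarticSymbolInt, map_natCast, map_one]
  exact quarticSymbol_span_natCast_intCast_eq_one_of_mod_four_eq_three isPrimitiveRoot_ζ₄ hq hq3 hqD

/-- `(D/(-q))₄ = 1` at the primary generator `-q` of an inert prime. [cite: IrelandRosen1982, Ch. 18 §6, Lemma before Theorem 7] -/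
theorem quarticSymbolInt_neg_natCast_of_mod_four_eq_three {q : ℕ} (hq : q.Prime) (hq3 : q % 4 = 3) {D : ℤ}
    (hqD : ¬ (q : ℤ) ∣ D) : quarticSymbolInt D (-(q : GaussianInt)) = 1 := by
  rw [show (-(q : GaussianInt)) = -1 * q by ring, quarticSymbolInt_isUnit_mul D isUnit_one.neg,
    quarticSymbolInt_natCast_of_mod_four_eq_three hq hq3 hqD]

end Values

/-! ### §2 The prime `3`: `(-3/x)₄ = (x/3)₄` -/

section Three

/-- `(-3/3)₄ = 0` (the prime `3` divides `-3`). [cite: IrelandRosen1982, Ch. 9 §8, Prop. 9.8.3 (a)] -/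
theorem quarticSymbolInt_neg_three_three : quarticSymbolInt (-3) 3 = 0 := by
  haveI := isCyclotomicExtension_K₄
  apply Φ₄.injective
  rw [map_quarticSymbolInt, map_zero, show (Φ₄ 3 : 𝓞 K₄) = ((3 : ℕ) : 𝓞 K₄) by rw [map_ofNat, Nat.cast_ofNat],
    quarticSymbol_span_of_span_eq (inertPlace_asIdeal (K := K₄) Nat.prime_three (by norm_num)),
    show (Ideal.Quotient.mk _ ((-3 : ℤ) : 𝓞 K₄)) = 0 from ?_]
  · exact quarticResidueSymbol_zero_of_two_not_mem isPrimitiveRoot_ζ₄ (two_not_mem_inertPlace Nat.prime_three (by norm_num))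
  · rw [Ideal.Quotient.eq_zero_iff_mem, inertPlace_asIdeal, Ideal.mem_span_singleton]
    exact ⟨-1, by push_cast; ring⟩

/-- **`(-3/x)₄ = (x/3)₄` for primary `x`** — the reciprocity law Prop. 9.9.8 (`a = -3 ≡ 1 (4)`) combined with Euler's
criterion at the inert prime `3` (`N(3) = 9`, `(x/3)₄ ≡ x² (mod 3)`); for `3 ∣ x` both sides vanish.  This is how the
prime `3` of `D = (-3)^k D₁` separates from the rest of the twist `(D/x)₄`. [cite: IrelandRosen1982, Ch. 9 §9, Prop. 9.9.8; Ch. 9 §8, Prop. 9.8.2] -/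
theorem quarticSymbolInt_neg_three_of_isPrimary {x : GaussianInt} (hx : IsPrimary x) :
    quarticSymbolInt (-3) x = quarticCharThree x := by
  haveI := isCyclotomicExtension_K₄
  by_cases h3 : (3 : GaussianInt) ∣ x
  · obtain ⟨y, rfl⟩ := h3
    have hy : y ≠ 0 := by rintro rfl; exact hx.ne_zero (mul_zero _)
    rw [quarticSymbolInt_mul (-3) (by decide) hy, quarticSymbolInt_neg_three_three, zero_mul,
      (quarticCharThree_eq_zero_iff _).mpr (dvd_mul_right 3 y)]
  · obtain ⟨hdvd, h4⟩ := three_dvd_sq_sub_quarticCharThree h3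
    have hcop : IsCoprime x ((-3 : ℤ) : GaussianInt) := by
      rw [Int.cast_neg, IsCoprime.neg_right_iff]
      -- `3 ≡ 3 (mod 4)` is prime in `ℤ[i]` (Mathlib's inert law; also the tree's `GaussianRat.prime_three`)
      have h3p : Prime (3 : GaussianInt) := by
        simpa using (GaussianInt.prime_iff_mod_four_eq_three_of_nat_prime 3).mpr (by norm_num)
      exact ((Irreducible.coprime_iff_not_dvd h3p.irreducible).mpr h3).symm
    apply Φ₄.injective
    rw [map_quarticSymbolInt_of_isPrimary (by decide) hx hcop,
      show ((-3 : ℤ) : 𝓞 K₄) = -((3 : ℕ) : 𝓞 K₄) by push_cast; ring, quarticSymbol_span_neg,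
      quarticSymbol_span_of_span_eq (inertPlace_asIdeal (K := K₄) Nat.prime_three (by norm_num))]
    refine quarticResidueSymbol_eq_of_pow_four_eq_one isPrimitiveRoot_ζ₄
      (two_not_mem_inertPlace Nat.prime_three (by norm_num)) (by rw [← map_pow, h4, map_one]) ?_
    rw [residueCard_inertPlace, show ((3 ^ 2 - 1) / 4 : ℕ) = 2 by norm_num, ← map_pow, eq_comm, Ideal.Quotient.eq,
      inertPlace_asIdeal, Ideal.mem_span_singleton, ← map_pow,
      show ((3 : ℕ) : 𝓞 K₄) = Φ₄ 3 by rw [map_ofNat, Nat.cast_ofNat], ← map_sub, map_dvd_iff]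
    exact hdvd

/-- **The `3`-part of the twist.**  For `D = (-3)^k · D₁` and a primary `x`: `(D/x)₄ = (x/3)₄^k · (D₁/x)₄`.
[cite: IrelandRosen1982, Ch. 9 §8, Prop. 9.8.3 (b); Ch. 9 §9, Prop. 9.9.8] -/
theorem quarticSymbolInt_neg_three_pow_mul_of_isPrimary (k : ℕ) (D₁ : ℤ) {x : GaussianInt} (hx : IsPrimary x) :
    quarticSymbolInt ((-3) ^ k * D₁) x = quarticCharThree x ^ k * quarticSymbolInt D₁ x := by
  rw [quarticSymbolInt_mul_left, quarticSymbolInt_pow_left _ _ hx, quarticSymbolInt_neg_three_of_isPrimary hx]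

end Three

end Literature.NumberTheory.QuadraticFields.GaussianQuarticSymbol

end
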